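import Summits.ABC.IUTFork.Joshi.TestThetaLocusSaturation
import Summits.ABC.IUTFork.Cor312PinnedGapNotNecessary
import HarnessLib

/-!
# TEST addendum: NO volume dictionary from a saturated Joshi locus to ANY setting of the cell's exponent-census family
# `expSetting p e` (the hull log-volumes there sum to `−5·log p < 0`) — kernel; located, not adjudicated

Test file of the abc-iut cell, branch E (rung LADDER-ABC:A2.E; seat abc-iut-E-t3; E-PLAN R14), sequel of
`Joshi/TestThetaLocusSaturation.lean` (p431044: `not_volumeDictionary_of_hullSum_neg`) over abc-iut-w5-d232's exponent-census family
`Cor312Vol.NaiveWitness.expSetting p e` (`Cor312PinnedGapNotNecessary`, p-id of record there: Θ-pilot images `B_{j²}`, q-pilot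
`B_{e_j}`, typed Thm. 3.11 (i)–(iii), the pins (pΘ)(pq′) and `BridgeHyps` for EVERY `e`; the typed Corollary ⟺ `e₁ + e₂ ≥ 5`).
Source on the Joshi side: arXiv:2303.01662 v3 (bib `Joshi2023ATS2Local`; UNREFEREED, D-0012). FRAMING: locates / conditionally
verifies; no abc claim; no side taken on [IUTchIII] Cor. 3.12 or on any author; typed ≠ proved ≠ endorsed. `S` occurs nowhere.

CONTENT (answers abc-iut-E-t2's INFO-3 on p429558 «no model of VolumeDictionary ∧ CanonicalPoint exhibited»): at the unique place of
`expSetting p e` the packet hulls are `B_1`, `B_4` (`withQDatum_thetaHull`), so `Σ_j logvol(ⁿ˒°𝒰_j) = −5·log p < 0`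
(`expSetting_hullSum_neg`); hence, given the root tower (`F = ℂ_p^♭` algebraically closed), NO prototype datum admits a
`VolumeDictionary` to any member of the family (`not_volumeDictionary_expSetting`) — including the members where the typed Corollary
HOLDS (`e₁ + e₂ ≥ 5`). A satisfiability witness for `VolumeDictionary ∧ RootTower` therefore needs a setting whose packet hulls at the
dictionary's place have NONNEGATIVE total log-volume (`hullSum_nonneg_of_volumeDictionary`): outside every honest `p`-adic ball model of
the cell. Reported as the LOCATION of Y_vol's content; no verdict. [claim: Joshi2023ATS2Local, status: disputed]
-/

noncomputable section

open Set

namespace Summit.ABC.IUTFork.Joshi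

open Thm311 Cor312 Cor312Vol Cor312Vol.NaiveWitness Cor312.Checks Literature.IUT.LogThetaLattice

variable {F B E0 : Type} [Field F] [CommRing B] [Field E0] {Y : Type} {K : Y → Type} [∀ y, Field (K y)] {G : Type}
  (p : ℕ) [hp : Fact p.Prime]

/-- At every label `j ∈ 𝔽_l^⋇` of `expSetting p e` the hull log-volume is `−j²·log p < 0` (hull `= B_{j²}`). [folklore] -/
theorem expSetting_hullTerm_neg (e : toyIndex.LabelStar → ℕ) (i : Fin toyIndex.lstar) (vQ : toyIndex.VQ) :
    ((naiveSituation p).D (expSetting p e).n).logvol (Setting.labelSucc i) vQ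
        ((expSetting p e).thetaHull (Setting.labelSucc i) vQ) < 0 := by
  unfold expSetting
  rw [withQDatum_thetaHull]
  show pVol p _ vQ (pBall p _ vQ (jsq (Setting.labelSucc i))) < 0
  rw [pVol_pBall]
  have hj : (0 : ℝ) < (jsq (Setting.labelSucc i : toyIndex.Label) : ℝ) := by
    have h1 : 1 ≤ ((Setting.labelSucc i : toyIndex.Label) : ℕ) := by
      rw [Nat.one_le_iff_ne_zero]
      exact fun h => Setting.labelSucc_ne_zero i (Fin.ext h)
    unfold jsq
    have : 1 ≤ ((Setting.labelSucc i : toyIndex.Label) : ℕ) ^ 2 := Nat.one_le_pow _ _ h1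
    exact_mod_cast this
  have hp' := log_p_pos p
  nlinarith

/-- Hence the label-sum of the hull log-volumes at any place of `expSetting p e` is NEGATIVE (`= −5·log p`). [folklore] -/
theorem expSetting_hullSum_neg (e : toyIndex.LabelStar → ℕ) (vQ : toyIndex.VQ) :
    ∑ i : Fin toyIndex.lstar, ((naiveSituation p).D (expSetting p e).n).logvol (Setting.labelSucc i) vQ
        ((expSetting p e).thetaHull (Setting.labelSucc i) vQ) < 0 :=
  Finset.sum_neg (fun i _ => expSetting_hullTerm_neg p e i vQ) ⟨⟨0, by decide⟩, Finset.mem_univ _⟩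

/-- **No volume dictionary to the exponent-census family**: for every prototype datum with a root tower, every exponent vector `e`
and every place, `¬ VolumeDictionary J (expSetting p e) v_ℚ` — in particular at the members `e₁ + e₂ ≥ 5` where the typed
Corollary 3.12 HOLDS. LOCATION of Y_vol's content, not a verdict. [claim: Joshi2023ATS2Local, status: disputed] -/
theorem not_volumeDictionary_expSetting (J : PrototypeDatum F B E0 Y K G) (r : J.RootTower) (e : toyIndex.LabelStar → ℕ)
    (vQ : toyIndex.VQ) : ¬ VolumeDictionary J (expSetting p e) vQ :=
  not_volumeDictionary_of_hullSum_neg r (expSetting_hullSum_neg p e vQ)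

end Summit.ABC.IUTFork.Joshi

end
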